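import Literature.Computability.ImplicitComplexity.SoftTypeAssignmentRemap
import Literature.Computability.ImplicitComplexity.SoftTypeAssignmentTySubst
import Literature.Computability.ImplicitComplexity.SoftTypeAssignmentClosed
import HarnessLib

/-!
# A typing kit for `STA₊` programs: list contexts, admissible rules, data types

Tools for writing `STA₊` typing derivations (GMR08 = Gaboardi–Marion–Ronchi Della Rocca 2008,
Table 2 + Table 5) of concrete programs, used for the NP-completeness half of
`STAPlusCapturesNP`:

* `TypingLe D Γ M σ` — typable with a derivation of degree `≤ D` (the final statement only bounds
  the degree), with the rules in this form;
* list contexts `Ctx.ofList`, the split `SplitL` of a list context, variables with weakening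
  built in (`typingLe_var`), weakening at an empty slot by ANY soft type (`Typing.weaken_slot`:
  rule `(w)` for linear, rule `(m)` with `n = 0` for modal assumptions), invariance under injective
  renaming of slots (`Typing.rename_inj`) and **raising the modality of a slot in place**
  (`Typing.raise`);
* closed linear types (`LinTy.ClosedT`) and the data types of the encoding: `tyE q` of
  `STAEncBasics.lean` (the `q`-element type `∀α.α ⊸ ⋯ ⊸ α ⊸ α`, GMR08 §3.2 booleans for `q = 2`), rows
  `Rty j U = ∀α.!ʲ(U ⊸ α ⊸ α) ⊸ α ⊸ α` (GMR08 §3.2 strings `Sⱼ` for `U = B`), numerals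
  `Nty i` (GMR08 §3.2 `Nᵢ`), the pair type `STof C A` of `⟨M, N⟩`, with their `(∀E)` instances.

## References

* [GaboardiMarionRonchidellarocca2008] Table 2, Table 5, §3.2.
-/

namespace Literature.Computability.ImplicitComplexity

namespace STA

open Term

/-! ### Degree-bounded typability -/

/-- `TypingLe D Γ M σ`: `Γ ⊢ M : σ` by a derivation of degree at most `D`. [cite: GaboardiMarionRonchidellarocca2008, Table 2, Def. A.1] -/
def TypingLe (D : ℕ) (Γ : Ctx) (M : Term) (σ : SoftTy) : Prop := ∃ d ≤ D, Typing d Γ M σ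

namespace TypingLe

variable {D D' d : ℕ} {Γ : Ctx} {M N : Term} {σ : SoftTy}

/-- An exact derivation bounds itself. [folklore] -/
theorem of_typing (h : Typing d Γ M σ) : TypingLe d Γ M σ := ⟨d, le_rfl, h⟩

/-- Monotonicity in the bound. [folklore] -/
theorem mono (h : TypingLe D Γ M σ) (hD : D ≤ D') : TypingLe D' Γ M σ := by
  obtain ⟨d, hd, h⟩ := h; exact ⟨d, hd.trans hD, h⟩

/-- Rule `(⊸I)`. [cite: GaboardiMarionRonchidellarocca2008, Table 2] -/
theorem lam {k : ℕ} {B A : LinTy} (h : TypingLe D (Ctx.cons (some ⟨k, B⟩) Γ) M ⟨0, A⟩) :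
    TypingLe D Γ (.lam M) ⟨0, .limp k B A⟩ := by
  obtain ⟨d, hd, h⟩ := h; exact ⟨d, hd, Typing.lam h⟩

/-- Rule `(⊸E)`. [cite: GaboardiMarionRonchidellarocca2008, Table 2] -/
theorem app {Γ₁ Γ₂ : Ctx} {k : ℕ} {B A : LinTy} (hs : Γ.Split Γ₁ Γ₂) (h₁ : TypingLe D Γ₁ M ⟨0, .limp k B A⟩)
    (h₂ : TypingLe D Γ₂ N ⟨k, B⟩) : TypingLe D Γ (.app M N) ⟨0, A⟩ := by
  obtain ⟨d₁, hd₁, h₁⟩ := h₁; obtain ⟨d₂, hd₂, h₂⟩ := h₂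
  exact ⟨max d₁ d₂, max_le hd₁ hd₂, Typing.app hs h₁ h₂⟩

/-- Rule `(⊸E)` for closed function and argument. [cite: GaboardiMarionRonchidellarocca2008, Table 2] -/
theorem app_empty {k : ℕ} {B A : LinTy} (h₁ : TypingLe D Ctx.empty M ⟨0, .limp k B A⟩)
    (h₂ : TypingLe D Ctx.empty N ⟨k, B⟩) : TypingLe D Ctx.empty (.app M N) ⟨0, A⟩ :=
  app (Ctx.Split.all_left _) h₁ h₂

/-- Rule `(sp)`. [cite: GaboardiMarionRonchidellarocca2008, Table 2] -/
theorem sp {k : ℕ} {A : LinTy} (h : TypingLe D Γ M ⟨k, A⟩) : TypingLe (D + 1) Γ.bang M ⟨k + 1, A⟩ := by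
  obtain ⟨d, hd, h⟩ := h; exact ⟨d + 1, by omega, Typing.sp h rfl⟩

/-- `(sp)` on a closed term, iterated: `⊢ M : A ⟹ ⊢ M : !ⁿA` with degree `+ n`. [cite: GaboardiMarionRonchidellarocca2008, Table 2] -/
theorem spN_empty {k : ℕ} {A : LinTy} (h : TypingLe D Ctx.empty M ⟨k, A⟩) (n : ℕ) :
    TypingLe (D + n) Ctx.empty M ⟨k + n, A⟩ := by
  induction n with
  | zero => exact h
  | succ n ih => exact ih.sp

/-- Rule `(∀I)`. [cite: GaboardiMarionRonchidellarocca2008, Table 2] -/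
theorem allI {A : LinTy} (h : TypingLe D Γ.shift M ⟨0, A⟩) : TypingLe D Γ M ⟨0, .all A⟩ := by
  obtain ⟨d, hd, h⟩ := h; exact ⟨d, hd, Typing.allI h rfl⟩

/-- Rule `(∀E)`. [cite: GaboardiMarionRonchidellarocca2008, Table 2] -/
theorem allE {B : LinTy} (A : LinTy) (h : TypingLe D Γ M ⟨0, .all B⟩) : TypingLe D Γ M ⟨0, B.inst A⟩ := by
  obtain ⟨d, hd, h⟩ := h; exact ⟨d, hd, Typing.allE A h⟩

/-- Rule `(sum)`. [cite: GaboardiMarionRonchidellarocca2008, Table 5] -/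
theorem sum {A : LinTy} (h₁ : TypingLe D Γ M ⟨0, A⟩) (h₂ : TypingLe D Γ N ⟨0, A⟩) : TypingLe D Γ (.sum M N) ⟨0, A⟩ := by
  obtain ⟨d₁, hd₁, h₁⟩ := h₁; obtain ⟨d₂, hd₂, h₂⟩ := h₂
  exact ⟨max d₁ d₂, max_le hd₁ hd₂, Typing.sum h₁ h₂⟩

/-- Rule `(m)`. [cite: GaboardiMarionRonchidellarocca2008, Table 2] -/
theorem mpx {Γ' : Ctx} {M' : Term} (S : Finset ℕ) (j : ℕ) {τ : SoftTy} (h : TypingLe D Γ M σ) (hS : ∀ i ∈ S, Γ i = some τ)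
    (hj : Γ j = none) (hΓ' : Γ' = Γ.mpx S j τ) (hM' : M' = M.rename (mpxRen S j)) : TypingLe D Γ' M' σ := by
  obtain ⟨d, hd, h⟩ := h; exact ⟨d, hd, Typing.mpx S j h hS hj hΓ' hM'⟩

/-- Transport along equal contexts. [folklore] -/
theorem of_eq_ctx {Γ' : Ctx} (h : TypingLe D Γ M σ) (e : Γ = Γ') : TypingLe D Γ' M σ := e ▸ h

/-- Transport along equal terms. [folklore] -/
theorem of_eq_tm {M' : Term} (h : TypingLe D Γ M σ) (e : M = M') : TypingLe D Γ M' σ := e ▸ h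

/-- Transport along equal types. [folklore] -/
theorem of_eq_ty {σ' : SoftTy} (h : TypingLe D Γ M σ) (e : σ = σ') : TypingLe D Γ M σ' := e ▸ h

end TypingLe

/-! ### Weakening, renaming of slots, raising a modality -/

/-- **Weakening at an empty slot by any soft type** (rule `(w)` for a linear type, rule `(m)` with
no premise occurrence for a modal one). [cite: GaboardiMarionRonchidellarocca2008, Table 2 (w), (m)] -/
theorem Typing.weaken_slot {d : ℕ} {Γ : Ctx} {M : Term} {σ : SoftTy} (h : Typing d Γ M σ) {j : ℕ} (hj : Γ j = none)
    (τ : SoftTy) : Typing d (Function.update Γ j (some τ)) M σ := by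
  obtain ⟨k, A⟩ := τ
  cases k with
  | zero => exact Typing.weak j A h hj rfl
  | succ k =>
    refine Typing.mpx ∅ j (σ := ⟨k, A⟩) h (by simp) hj ?_ ?_
    · rw [Ctx.mpx_empty]; rfl
    · rw [mpxRen_empty, rename_id]

/-- The same for degree-bounded typability. [folklore] -/
theorem TypingLe.weaken_slot {D : ℕ} {Γ : Ctx} {M : Term} {σ : SoftTy} (h : TypingLe D Γ M σ) {j : ℕ} (hj : Γ j = none)
    (τ : SoftTy) : TypingLe D (Function.update Γ j (some τ)) M σ := by
  obtain ⟨d, hd, h⟩ := h; exact ⟨d, hd, h.weaken_slot hj τ⟩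

/-- **Invariance of typing under injective renaming of variable slots.** [folklore] -/
theorem Typing.rename_inj {d : ℕ} {Γ : Ctx} {M : Term} {σ : SoftTy} (h : Typing d Γ M σ)
    {ρ : ℕ → ℕ} (hρ : Function.Injective ρ) : Typing d (Γ.remap ρ) (M.rename ρ) σ := by
  induction h generalizing ρ with
  | ax hΓ => exact Typing.ax (hΓ.remap hρ)
  | weak j A _ hj hΓ' ih =>
    subst hΓ'
    refine Typing.weak (ρ j) A (ih hρ) ?_ (Ctx.remap_update hρ _ _ _)
    rw [Ctx.remap_apply hρ]
    exact hj
  | lam _ ih =>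
    refine Typing.lam ?_
    have := ih (liftRen_injective hρ)
    rwa [Ctx.remap_cons_liftRen hρ] at this
  | app hs _ _ ih₁ ih₂ => exact Typing.app (hs.remap hρ) (ih₁ hρ) (ih₂ hρ)
  | @mpx d Γ Γ' M M' μ σ S j _ hS hj hΓ' hM' ih =>
    subst hΓ' hM'
    refine Typing.mpx (S.image ρ) (ρ j) (ih hρ) ?_ ?_ (Ctx.remap_mpx hρ _ _ _ _) (Term.rename_mpxRen_rename hρ _ _ _)
    · intro i hi
      obtain ⟨i₀, hi₀, rfl⟩ := Finset.mem_image.1 hi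
      rw [Ctx.remap_apply hρ]
      exact hS i₀ hi₀
    · rw [Ctx.remap_apply hρ]
      exact hj
  | sp _ hΓ' ih =>
    subst hΓ'
    exact Typing.sp (ih hρ) (Ctx.remap_bang hρ _)
  | allI _ hΔ ih =>
    subst hΔ
    exact Typing.allI (ih hρ) (Ctx.remap_shift hρ _)
  | allE A _ ih => exact Typing.allE A (ih hρ)
  | sum _ _ ih₁ ih₂ => exact Typing.sum (ih₁ hρ) (ih₂ hρ)

/-- A derivation under a new, unused innermost binder. [folklore] -/
theorem Typing.shift_succ {d : ℕ} {Γ : Ctx} {M : Term} {σ : SoftTy} (h : Typing d Γ M σ) :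
    Typing d (Ctx.cons none Γ) (M.rename Nat.succ) σ := by
  have := h.rename_inj Nat.succ_injective
  rwa [Ctx.remap_succ] at this

/-- **Raising the modality of a slot in place**: `Γ, x : σ ⊢ M : μ ⟹ Γ, x : !σ ⊢ M : μ`
(rename `x` to a fresh slot, then rule `(m)` with one premise occurrence back onto `x`).
[cite: GaboardiMarionRonchidellarocca2008, Table 2 (m)] -/
theorem Typing.raise {d : ℕ} {Γ : Ctx} {M : Term} {μ : SoftTy} (h : Typing d Γ M μ) {i : ℕ} {τ : SoftTy}
    (hi : Γ i = some τ) {J : ℕ} (hJΓ : Γ J = none) (hJM : J ∉ M.fv) :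
    Typing d (Function.update Γ i (some τ.bang)) M μ := by
  have hiJ : i ≠ J := fun e => by rw [e, hJΓ] at hi; cases hi
  have hρ : Function.Injective (Equiv.swap i J) := (Equiv.swap i J).injective
  have h1 := h.rename_inj hρ
  have eJ : Ctx.remap (Equiv.swap i J) Γ J = Γ i := by
    have := Ctx.remap_apply hρ Γ i; rwa [Equiv.swap_apply_left] at this
  have ei : Ctx.remap (Equiv.swap i J) Γ i = Γ J := by
    have := Ctx.remap_apply hρ Γ J; rwa [Equiv.swap_apply_right] at this
  have eo : ∀ x, x ≠ i → x ≠ J → Ctx.remap (Equiv.swap i J) Γ x = Γ x := by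
    intro x hxi hxJ
    have := Ctx.remap_apply hρ Γ x; rwa [Equiv.swap_apply_of_ne_of_ne hxi hxJ] at this
  refine Typing.mpx {J} i (σ := τ) h1 ?_ ?_ ?_ ?_
  · intro x hx
    rw [Finset.mem_singleton] at hx; subst hx
    rw [eJ]; exact hi
  · rw [ei]; exact hJΓ
  · funext x
    simp only [Function.update, Ctx.mpx, Finset.mem_singleton]
    by_cases hxJ : x = J
    · subst hxJ
      rw [if_pos rfl, dif_neg (Ne.symm hiJ), hJΓ]
    · rw [if_neg hxJ]
      by_cases hxi : x = i
      · subst hxi; simp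
      · rw [dif_neg hxi, if_neg hxi, eo x hxi hxJ]
  · rw [rename_rename]
    refine (rename_id_of_fv fun x hx => ?_).symm
    simp only [Function.comp_apply, mpxRen, Finset.mem_singleton]
    by_cases hxi : x = i
    · subst hxi; simp
    · have hxJ : x ≠ J := fun e => hJM (e ▸ hx)
      rw [Equiv.swap_apply_of_ne_of_ne hxi hxJ, if_neg hxJ]

/-- Raising the modality of a slot by `n`. [cite: GaboardiMarionRonchidellarocca2008, Table 2 (m)] -/
theorem Typing.raiseN {d : ℕ} {Γ : Ctx} {M : Term} {μ : SoftTy} (h : Typing d Γ M μ) {i : ℕ} {k : ℕ} {A : LinTy}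
    (hi : Γ i = some ⟨k, A⟩) {J : ℕ} (hJΓ : Γ J = none) (hJM : J ∉ M.fv) (n : ℕ) :
    Typing d (Function.update Γ i (some ⟨k + n, A⟩)) M μ := by
  induction n with
  | zero => rw [Nat.add_zero, ← hi, Function.update_eq_self]; exact h
  | succ n ih =>
    have hiJ : i ≠ J := fun e => by rw [e, hJΓ] at hi; cases hi
    have := ih.raise (i := i) (τ := ⟨k + n, A⟩) (by simp) (J := J) (by simp [Function.update, Ne.symm hiJ, hJΓ]) hJM
    simpa [SoftTy.bang, Nat.add_assoc] using this

/-! ### List contexts -/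

/-- The context of a list of optional assumptions (slot `i ↦ l[i]`, nothing beyond). [folklore] -/
def Ctx.ofList (l : List (Option SoftTy)) : Ctx := fun i => (l[i]?).getD none

/-- Entries of a list context. [folklore] -/
@[simp] theorem Ctx.ofList_apply (l : List (Option SoftTy)) (i : ℕ) : Ctx.ofList l i = (l[i]?).getD none := rfl

/-- The empty list is the empty context. [folklore] -/
@[simp] theorem Ctx.ofList_nil : Ctx.ofList [] = Ctx.empty := rfl

/-- `ofList (a :: l) = cons a (ofList l)`. [folklore] -/
theorem Ctx.ofList_cons (a : Option SoftTy) (l : List (Option SoftTy)) : Ctx.ofList (a :: l) = Ctx.cons a (Ctx.ofList l) := by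
  funext i; cases i <;> rfl

/-- A list of empty slots is the empty context. [folklore] -/
theorem Ctx.ofList_replicate_none (n : ℕ) : Ctx.ofList (List.replicate n none) = Ctx.empty := by
  funext i
  simp only [ofList_apply, Ctx.empty]
  cases h : (List.replicate n (none : Option SoftTy))[i]? with
  | none => rfl
  | some a => rw [List.getElem?_replicate] at h; split_ifs at h; cases h; rfl

/-- `!` of a list context. [folklore] -/
theorem Ctx.ofList_bang (l : List (Option SoftTy)) : (Ctx.ofList l).bang = Ctx.ofList (l.map (Option.map SoftTy.bang)) := by
  funext i
  simp only [Ctx.bang, ofList_apply, List.getElem?_map]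
  cases l[i]? <;> rfl

/-- Shift of a list context. [folklore] -/
theorem Ctx.ofList_shift (l : List (Option SoftTy)) : (Ctx.ofList l).shift = Ctx.ofList (l.map (Option.map SoftTy.shift)) := by
  funext i
  simp only [Ctx.shift, ofList_apply, List.getElem?_map]
  cases l[i]? <;> rfl

/-- Updating a slot of a list context. [folklore] -/
theorem Ctx.ofList_set (l : List (Option SoftTy)) {j : ℕ} (hj : j < l.length) (a : Option SoftTy) :
    Function.update (Ctx.ofList l) j a = Ctx.ofList (l.set j a) := by
  funext i
  by_cases h : i = j
  · subst h; simp [hj]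
  · rw [Function.update_of_ne h]; simp [List.getElem?_set_ne (Ne.symm h)]

/-- Splitting a list context entrywise. [folklore] -/
def SplitL : List (Option SoftTy) → List (Option SoftTy) → List (Option SoftTy) → Prop
  | [], [], [] => True
  | a :: l, b :: l₁, c :: l₂ => ((b = a ∧ c = none) ∨ (b = none ∧ c = a)) ∧ SplitL l l₁ l₂
  | _, _, _ => False

/-- An entrywise split is a split of contexts. [cite: GaboardiMarionRonchidellarocca2008, Table 2 (⊸E)] -/
theorem SplitL.split : ∀ {l l₁ l₂ : List (Option SoftTy)}, SplitL l l₁ l₂ → (Ctx.ofList l).Split (Ctx.ofList l₁) (Ctx.ofList l₂)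
  | [], [], [], _ => fun _ => Or.inl ⟨rfl, rfl⟩
  | _ :: _, b :: _, c :: _, h => by
    intro i
    cases i with
    | zero =>
      rcases h.1 with ⟨hb, hc⟩ | ⟨hb, hc⟩
      · exact Or.inl ⟨by simp [hb], by simp [hc]⟩
      · exact Or.inr ⟨by simp [hb], by simp [hc]⟩
    | succ i => simpa [Ctx.ofList] using SplitL.split h.2 i
  | [], [], _ :: _, h => h.elim
  | [], _ :: _, _, h => h.elim
  | _ :: _, [], _, h => h.elim
  | _ :: _, _ :: _, [], h => h.elim

namespace TypingLe

variable {D : ℕ} {M N : Term}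

/-- `(⊸E)` on list contexts. [cite: GaboardiMarionRonchidellarocca2008, Table 2 (⊸E)] -/
theorem appL {l l₁ l₂ : List (Option SoftTy)} (hs : SplitL l l₁ l₂) {k : ℕ} {B A : LinTy}
    (h₁ : TypingLe D (Ctx.ofList l₁) M ⟨0, .limp k B A⟩) (h₂ : TypingLe D (Ctx.ofList l₂) N ⟨k, B⟩) :
    TypingLe D (Ctx.ofList l) (.app M N) ⟨0, A⟩ :=
  app hs.split h₁ h₂

/-- `(⊸I)` on list contexts. [cite: GaboardiMarionRonchidellarocca2008, Table 2 (⊸I)] -/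
theorem lamL {l : List (Option SoftTy)} {k : ℕ} {B A : LinTy} (h : TypingLe D (Ctx.ofList (some ⟨k, B⟩ :: l)) M ⟨0, A⟩) :
    TypingLe D (Ctx.ofList l) (.lam M) ⟨0, .limp k B A⟩ := by
  rw [Ctx.ofList_cons] at h; exact h.lam

/-- `(sp)` on list contexts. [cite: GaboardiMarionRonchidellarocca2008, Table 2 (sp)] -/
theorem spL {l : List (Option SoftTy)} {k : ℕ} {A : LinTy} (h : TypingLe D (Ctx.ofList l) M ⟨k, A⟩) :
    TypingLe (D + 1) (Ctx.ofList (l.map (Option.map SoftTy.bang))) M ⟨k + 1, A⟩ := by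
  rw [← Ctx.ofList_bang]; exact h.sp

/-- `(∀I)` on list contexts. [cite: GaboardiMarionRonchidellarocca2008, Table 2 (∀I)] -/
theorem allIL {l : List (Option SoftTy)} {A : LinTy} (h : TypingLe D (Ctx.ofList (l.map (Option.map SoftTy.shift))) M ⟨0, A⟩) :
    TypingLe D (Ctx.ofList l) M ⟨0, .all A⟩ := by
  rw [← Ctx.ofList_shift] at h; exact h.allI

/-- A closed typing in a list of empty slots. [folklore] -/
theorem emptyL {σ : SoftTy} (h : TypingLe D Ctx.empty M σ) (n : ℕ) : TypingLe D (Ctx.ofList (List.replicate n none)) M σ := by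
  rwa [Ctx.ofList_replicate_none]

end TypingLe

/-- The singleton context of a variable, with its modality obtained by `(sp)`. [cite: GaboardiMarionRonchidellarocca2008, Table 2 (Ax), (sp)] -/
theorem typing_var_single (i k : ℕ) (A : LinTy) :
    Typing k (fun j => if j = i then some ⟨k, A⟩ else none) (.var i) ⟨k, A⟩ := by
  induction k with
  | zero => exact Typing.ax ⟨by simp, fun j hj => by simp [hj]⟩
  | succ k ih =>
    refine Typing.sp ih ?_
    funext j
    by_cases hj : j = i <;> simp [Ctx.bang, hj, SoftTy.bang]

/-- **A variable in a list context** (the other assumptions weakened in). [cite: GaboardiMarionRonchidellarocca2008, Table 2 (Ax), (w), (m), (sp)] -/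
theorem typing_var_ofList {l : List (Option SoftTy)} {i k : ℕ} {A : LinTy} (h : l[i]? = some (some ⟨k, A⟩)) :
    Typing k (Ctx.ofList l) (.var i) ⟨k, A⟩ := by
  have hi : i < l.length := by
    by_contra hlt; rw [List.getElem?_eq_none (by omega)] at h; cases h
  -- add the slots `< m`, one at a time
  let G : ℕ → Ctx := fun m x => if x = i then some ⟨k, A⟩ else if x < m then Ctx.ofList l x else none
  have hG : ∀ m, Typing k (G m) (.var i) ⟨k, A⟩ := by
    intro m
    induction m with
    | zero =>
      have : G 0 = fun j => if j = i then some ⟨k, A⟩ else none := by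
        funext x; by_cases hx : x = i <;> simp [G, hx]
      rw [this]; exact typing_var_single i k A
    | succ m ih =>
      have hagree : ∀ x, x ≠ m → G (m + 1) x = G m x := by
        intro x hxm
        by_cases hx : x = i
        · simp [G, hx]
        · by_cases hlt : x < m
          · simp [G, hx, hlt, show x < m + 1 by omega]
          · simp [G, hx, hlt, show ¬ x < m + 1 by omega]
      by_cases hmi : m = i
      · have : G (m + 1) = G m := by
          funext x
          by_cases hxm : x = m
          · subst hxm; simp [G, hmi]
          · exact hagree x hxm
        rw [this]; exact ih
      · have hGm : G m m = none := by simp [G, hmi]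
        cases hlm : Ctx.ofList l m with
        | none =>
          have : G (m + 1) = G m := by
            funext x
            by_cases hxm : x = m
            · subst hxm
              rw [hGm]; simp only [G, if_neg hmi, if_pos (Nat.lt_succ_self _)]; exact hlm
            · exact hagree x hxm
          rw [this]; exact ih
        | some τ =>
          have : G (m + 1) = Function.update (G m) m (some τ) := by
            funext x
            by_cases hxm : x = m
            · subst hxm
              rw [Function.update_self]; simp only [G, if_neg hmi, if_pos (Nat.lt_succ_self _)]; exact hlm
            · rw [Function.update_of_ne hxm]; exact hagree x hxm
          rw [this]; exact ih.weaken_slot hGm τ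
  have hfin : G l.length = Ctx.ofList l := by
    funext x
    by_cases hx : x = i
    · subst hx; simp [G, h]
    · by_cases hxl : x < l.length
      · simp [G, hxl, hx]
      · simp [G, hxl, hx]
  rw [← hfin]; exact hG l.length

/-- A variable in a list context, degree-bounded form. [folklore] -/
theorem typingLe_var {l : List (Option SoftTy)} {i k : ℕ} {A : LinTy} (h : l[i]? = some (some ⟨k, A⟩)) {D : ℕ} (hD : k ≤ D) :
    TypingLe D (Ctx.ofList l) (.var i) ⟨k, A⟩ := ⟨k, hD, typing_var_ofList h⟩

/-! ### Closed linear types -/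

namespace LinTy

/-- `A.bndT n`: the free type variables of `A` are `< n`. [folklore] -/
def bndT : ℕ → LinTy → Bool
  | n, .tvar i => decide (i < n)
  | n, .limp _ d c => bndT n d && bndT n c
  | n, .all b => bndT (n + 1) b

/-- Renamings agreeing below the bound act equally on a bounded type. [folklore] -/
theorem rename_congr_bndT : ∀ {n : ℕ} {A : LinTy}, A.bndT n = true → ∀ {ρ ρ' : ℕ → ℕ}, (∀ i < n, ρ i = ρ' i) →
    A.rename ρ = A.rename ρ'
  | n, .tvar i, h, ρ, ρ', hρ => by
    simp only [bndT, decide_eq_true_eq] at h; simp [LinTy.rename, hρ i h]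
  | n, .limp k d c, h, ρ, ρ', hρ => by
    simp only [bndT, Bool.and_eq_true] at h
    simp [LinTy.rename, rename_congr_bndT h.1 hρ, rename_congr_bndT h.2 hρ]
  | n, .all b, h, ρ, ρ', hρ => by
    simp only [bndT] at h
    simp only [LinTy.rename, LinTy.all.injEq]
    refine rename_congr_bndT h fun i hi => ?_
    cases i with
    | zero => rfl
    | succ i => simp [liftRen, hρ i (by omega)]

/-- Substitutions agreeing below the bound act equally on a bounded type. [folklore] -/
theorem substp_congr_bndT : ∀ {n : ℕ} {A : LinTy}, A.bndT n = true → ∀ {τ τ' : ℕ → LinTy}, (∀ i < n, τ i = τ' i) →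
    A.substp τ = A.substp τ'
  | n, .tvar i, h, τ, τ', hτ => by
    simp only [bndT, decide_eq_true_eq] at h; simp [LinTy.substp, hτ i h]
  | n, .limp k d c, h, τ, τ', hτ => by
    simp only [bndT, Bool.and_eq_true] at h
    simp [LinTy.substp, substp_congr_bndT h.1 hτ, substp_congr_bndT h.2 hτ]
  | n, .all b, h, τ, τ', hτ => by
    simp only [bndT] at h
    simp only [LinTy.substp, LinTy.all.injEq]
    refine substp_congr_bndT h fun i hi => ?_
    cases i with
    | zero => rfl
    | succ i => simp [LinTy.up, hτ i (by omega)]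

/-- Closed linear types. [folklore] -/
def ClosedT (A : LinTy) : Prop := A.bndT 0 = true

/-- Closedness of types is decidable. [folklore] -/
instance : DecidablePred ClosedT := fun A => inferInstanceAs (Decidable (A.bndT 0 = true))

/-- Closed types are invariant under renaming. [folklore] -/
@[simp] theorem ClosedT.rename_eq {A : LinTy} (h : A.ClosedT) (ρ : ℕ → ℕ) : A.rename ρ = A := by
  rw [rename_congr_bndT h (ρ' := id) fun i hi => absurd hi (Nat.not_lt_zero i), LinTy.rename_id]

/-- Closed types are invariant under substitution. [folklore] -/
@[simp] theorem ClosedT.substp_eq {A : LinTy} (h : A.ClosedT) (τ : ℕ → LinTy) : A.substp τ = A := by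
  rw [substp_congr_bndT h (τ' := LinTy.tvar) fun i hi => absurd hi (Nat.not_lt_zero i), LinTy.substp_tvar]

/-- Closed types are invariant under `(∀E)`-instantiation contexts: `A.inst X` when... (unused form);
the shift of a closed soft type is itself. [folklore] -/
theorem ClosedT.shift_eq {σ : SoftTy} (h : σ.lin.ClosedT) : σ.shift = σ := by
  cases σ; simp [SoftTy.shift, ClosedT.rename_eq h]

end LinTy

/-- A list context of closed types is shift-invariant. [folklore] -/
theorem shiftL_closed {l : List (Option SoftTy)} (h : ∀ a ∈ l, ∀ σ, a = some σ → σ.lin.ClosedT) :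
    l.map (Option.map SoftTy.shift) = l := by
  refine (List.map_congr_left fun a ha => ?_).trans (List.map_id' l)
  cases a with
  | none => rfl
  | some σ => exact congrArg some (LinTy.ClosedT.shift_eq (h _ ha σ rfl))

/-! ### The data types of the encoding -/

/-- `D ⊸ (D ⊸ ⋯ (D ⊸ R))` with `q` linear arguments: shorthand for `LinTy.arrows` of
`STAEncBasics.lean` on a replicated linear domain (so that `tyE q = ∀α. arr q α α`). [folklore] -/
abbrev arr (q : ℕ) (D R : LinTy) : LinTy := LinTy.arrows (List.replicate q ⟨0, D⟩) R

/-- No argument. [folklore] -/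
@[simp] theorem arr_zero (D R : LinTy) : arr 0 D R = R := rfl

/-- One more argument. [folklore] -/
theorem arr_succ (q : ℕ) (D R : LinTy) : arr (q + 1) D R = .limp 0 D (arr q D R) := rfl

/-- Bound of `arr`. [folklore] -/
theorem bndT_arr {n : ℕ} {D R : LinTy} (hD : D.bndT n = true) (hR : R.bndT n = true) (q : ℕ) : (arr q D R).bndT n = true := by
  induction q with
  | zero => exact hR
  | succ q ih => rw [arr_succ]; simp [LinTy.bndT, hD, ih]

/-- `tyE q` (`STAEncBasics.lean`) is closed. [folklore] -/
theorem closedT_tyE (q : ℕ) : (tyE q).ClosedT := by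
  simp only [LinTy.ClosedT, tyE, LinTy.bndT]
  exact bndT_arr (by decide) (by decide) q

/-- Substitution through `arr`. [folklore] -/
theorem substp_arr (q : ℕ) (D R : LinTy) (τ : ℕ → LinTy) : (arr q D R).substp τ = arr q (D.substp τ) (R.substp τ) := by
  induction q with
  | zero => rfl
  | succ q ih => rw [arr_succ, arr_succ]; simp [LinTy.substp, ih]

/-- `(∀E)` on `tyE q`: `(α ⊸ ⋯ ⊸ α)[X/α] = X ⊸ ⋯ ⊸ X`. [cite: GaboardiMarionRonchidellarocca2008, Table 2 (∀E)] -/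
theorem inst_arr_tvar (q : ℕ) (X : LinTy) : (arr q (.tvar 0) (.tvar 0)).inst X = arr q X X := by
  rw [LinTy.inst, substp_arr]; rfl

/-- The type `U ⊸ α ⊸ α` of the list constructor. [cite: GaboardiMarionRonchidellarocca2008, §3.2] -/
def Fty (U : LinTy) : LinTy := .limp 0 U (.limp 0 (.tvar 0) (.tvar 0))

/-- Rows `Rty j U = ∀α.!ʲ(U ⊸ α ⊸ α) ⊸ α ⊸ α` (Church lists over `U`; `S_j = Rty j B`). [cite: GaboardiMarionRonchidellarocca2008, §3.2] -/
def Rty (j : ℕ) (U : LinTy) : LinTy := .all (.limp j (Fty U) (.limp 0 (.tvar 0) (.tvar 0)))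

/-- `S_m = Rty m B`. [cite: GaboardiMarionRonchidellarocca2008, §3.2] -/
theorem tyS_eq_Rty (m : ℕ) : tyS m = Rty m tyB := rfl

/-- `Rty j U` is closed for closed `U`. [folklore] -/
theorem closedT_Rty (j : ℕ) {U : LinTy} (hU : U.ClosedT) : (Rty j U).ClosedT := by
  have : U.bndT 1 = true := by
    have h0 : U.bndT 0 = true := hU
    -- monotonicity of the bound, proved inline
    suffices ∀ {n m : ℕ} {A : LinTy}, A.bndT n = true → n ≤ m → A.bndT m = true from this h0 (by omega)
    intro n m A
    induction A generalizing n m with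
    | tvar i => intro h hnm; simp only [LinTy.bndT, decide_eq_true_eq] at h ⊢; omega
    | limp k d c ihd ihc => intro h hnm; simp only [LinTy.bndT, Bool.and_eq_true] at h ⊢; exact ⟨ihd h.1 hnm, ihc h.2 hnm⟩
    | all b ih => intro h hnm; simp only [LinTy.bndT] at h ⊢; exact ih h (by omega)
  simp [LinTy.ClosedT, Rty, Fty, LinTy.bndT, this]

/-- `(∀E)` on rows: the body of `Rty j U` at `X`. [cite: GaboardiMarionRonchidellarocca2008, Table 2 (∀E)] -/
theorem inst_Rty_body (j : ℕ) {U : LinTy} (hU : U.ClosedT) (X : LinTy) :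
    (LinTy.limp j (Fty U) (.limp 0 (.tvar 0) (.tvar 0))).inst X = .limp j (.limp 0 U (.limp 0 X X)) (.limp 0 X X) := by
  simp [LinTy.inst, LinTy.substp, Fty, hU.substp_eq]

/-- Numerals `Nty i = ∀α.!ⁱ(α ⊸ α) ⊸ α ⊸ α`. [cite: GaboardiMarionRonchidellarocca2008, §3.2] -/
def Nty (i : ℕ) : LinTy := .all (.limp i (.limp 0 (.tvar 0) (.tvar 0)) (.limp 0 (.tvar 0) (.tvar 0)))

/-- `Nty i` is closed. [folklore] -/
theorem closedT_Nty (i : ℕ) : (Nty i).ClosedT := by simp [LinTy.ClosedT, Nty, LinTy.bndT]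

/-- `(∀E)` on numerals. [cite: GaboardiMarionRonchidellarocca2008, Table 2 (∀E)] -/
theorem inst_Nty_body (i : ℕ) (X : LinTy) :
    (LinTy.limp i (.limp 0 (.tvar 0) (.tvar 0)) (.limp 0 (.tvar 0) (.tvar 0))).inst X = .limp i (.limp 0 X X) (.limp 0 X X) := by
  simp [LinTy.inst, LinTy.substp]

/-- The type `STof C A = ∀β.(C ⊸ A ⊸ β) ⊸ β` of pairs `⟨q, acc⟩` with `q : C`, `acc : A`. [cite: GaboardiMarionRonchidellarocca2008, §3.2 (`⟨M,N⟩`)] -/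
def STof (C A : LinTy) : LinTy :=
  .all (.limp 0 (.limp 0 (C.rename Nat.succ) (.limp 0 (A.rename Nat.succ) (.tvar 0))) (.tvar 0))

/-- `(∀E)` on pairs: `((C ⊸ A ⊸ β) ⊸ β)[X/β] = (C ⊸ A ⊸ X) ⊸ X`. [cite: GaboardiMarionRonchidellarocca2008, Table 2 (∀E)] -/
theorem inst_STof_body (C A X : LinTy) :
    (LinTy.limp 0 (.limp 0 (C.rename Nat.succ) (.limp 0 (A.rename Nat.succ) (.tvar 0))) (.tvar 0)).inst X =
      .limp 0 (.limp 0 C (.limp 0 A X)) X := by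
  have hC := LinTy.inst_rename_succ C X
  have hA := LinTy.inst_rename_succ A X
  unfold LinTy.inst at hC hA ⊢
  simp [LinTy.substp, hC, hA]

/-- Shift of `STof C A` renames `C`, `A` (needed for `(∀I)` over open `A`). [folklore] -/
theorem STof_rename_succ (C A : LinTy) :
    (STof C A).rename Nat.succ = STof (C.rename Nat.succ) (A.rename Nat.succ) := by
  simp [STof, LinTy.rename, liftRen, LinTy.rename_liftRen_rename_succ]

end STA

end Literature.Computability.ImplicitComplexity
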